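import Summits.Ventures.PercRepro.RankLevelSetLevelSevenT21Dev1
import Summits.Ventures.PercRepro.RankLevelSetLevelSevenT21Dev2
import Summits.Ventures.PercRepro.RankLevelSetLevelSevenT21Dev3
import Summits.Ventures.PercRepro.RankLevelSetLevelSevenT21Dev4
import Summits.Ventures.PercRepro.RankLevelSetLevelSevenT21Dev5
import Summits.Ventures.PercRepro.RankLevelSetLevelSevenT21Dev6
import Summits.Ventures.PercRepro.S4MidKeyTwentyone
import Summits.Ventures.PercRepro.S4SevenWindow
import Summits.Ventures.PercRepro.RankLevelSetLevelSixRowsNineToFifteen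

/-!
# PercRepro — THE 21 ROW OF LEVEL `7`: `c025_core_seven_twentyone (d ≥ 8) : RLS M 21 7` ON EVERY `e`-FREE CORE OF RANK `21`, AND
**THEOREM C₇ AT RANK `21`** (p7 g25, S4 feeder; p8's assembly shape — NO window claim, p9 owns S4)

The core cells `(21, d)`: `8 ≤ d ≤ 78` by the coloop device with the lossy ladder (`c025_core_seven_twentyone_<d>`: `k` coloops reduce to the natural cell
`(21 − k, d)` of the row `21 − k` at the same corank, the rest retired — the generic device `c025_core_seven_of_cells_free` in RankLevelSetLevelSevenT21Dev1, RankLevelSetLevelSevenT21Dev2, RankLevelSetLevelSevenT21Dev3, RankLevelSetLevelSevenT21Dev4, RankLevelSetLevelSevenT21Dev5, RankLevelSetLevelSevenT21Dev6),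
`d ≥ 79` by p1's middle key (`S4Mid.c025_core_seven_midkey_twentyone`, no coloop-freeness needed). Then the level-6 glue `rls_seven_at_of_core 21` on `c025_six_all`
(level `6` at `p = 20`) gives level `7` at `p = 21`: **`c025_seven_at_twentyone : RLS M 21 7`** for every finite matroid.
Axioms: standard.
-/

open scoped Matroid

namespace PercRepro

namespace ThmN

variable {α : Type}

/-- **The core cell `(21, d)` at every corank `d ≥ 8`, every `e`-free core.** -/
theorem c025_core_seven_twentyone (M : Matroid α) [M.Finite] (d : ℕ) (hd8 : 8 ≤ d)
    (hR : M.eRank = (21 : ℕ∞)) (hn : M.E.ncard = 21 + d)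
    (hfree : ∀ e ∈ M.E, ∃ A ⊆ M.E \ {e}, e ∉ M.closure A ∧ e ∉ M.closure ((M.E \ {e}) \ A)) :
    RLS M 21 7 := by
  rcases Nat.lt_or_ge d 79 with hlt | hge
  · interval_cases d
    · exact c025_core_seven_twentyone_8 M hR hn hfree
    · exact c025_core_seven_twentyone_9 M hR hn hfree
    · exact c025_core_seven_twentyone_10 M hR hn hfree
    · exact c025_core_seven_twentyone_11 M hR hn hfree
    · exact c025_core_seven_twentyone_12 M hR hn hfree
    · exact c025_core_seven_twentyone_13 M hR hn hfree
    · exact c025_core_seven_twentyone_14 M hR hn hfree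
    · exact c025_core_seven_twentyone_15 M hR hn hfree
    · exact c025_core_seven_twentyone_16 M hR hn hfree
    · exact c025_core_seven_twentyone_17 M hR hn hfree
    · exact c025_core_seven_twentyone_18 M hR hn hfree
    · exact c025_core_seven_twentyone_19 M hR hn hfree
    · exact c025_core_seven_twentyone_20 M hR hn hfree
    · exact c025_core_seven_twentyone_21 M hR hn hfree
    · exact c025_core_seven_twentyone_22 M hR hn hfree
    · exact c025_core_seven_twentyone_23 M hR hn hfree
    · exact c025_core_seven_twentyone_24 M hR hn hfree
    · exact c025_core_seven_twentyone_25 M hR hn hfree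
    · exact c025_core_seven_twentyone_26 M hR hn hfree
    · exact c025_core_seven_twentyone_27 M hR hn hfree
    · exact c025_core_seven_twentyone_28 M hR hn hfree
    · exact c025_core_seven_twentyone_29 M hR hn hfree
    · exact c025_core_seven_twentyone_30 M hR hn hfree
    · exact c025_core_seven_twentyone_31 M hR hn hfree
    · exact c025_core_seven_twentyone_32 M hR hn hfree
    · exact c025_core_seven_twentyone_33 M hR hn hfree
    · exact c025_core_seven_twentyone_34 M hR hn hfree
    · exact c025_core_seven_twentyone_35 M hR hn hfree
    · exact c025_core_seven_twentyone_36 M hR hn hfree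
    · exact c025_core_seven_twentyone_37 M hR hn hfree
    · exact c025_core_seven_twentyone_38 M hR hn hfree
    · exact c025_core_seven_twentyone_39 M hR hn hfree
    · exact c025_core_seven_twentyone_40 M hR hn hfree
    · exact c025_core_seven_twentyone_41 M hR hn hfree
    · exact c025_core_seven_twentyone_42 M hR hn hfree
    · exact c025_core_seven_twentyone_43 M hR hn hfree
    · exact c025_core_seven_twentyone_44 M hR hn hfree
    · exact c025_core_seven_twentyone_45 M hR hn hfree
    · exact c025_core_seven_twentyone_46 M hR hn hfree
    · exact c025_core_seven_twentyone_47 M hR hn hfree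
    · exact c025_core_seven_twentyone_48 M hR hn hfree
    · exact c025_core_seven_twentyone_49 M hR hn hfree
    · exact c025_core_seven_twentyone_50 M hR hn hfree
    · exact c025_core_seven_twentyone_51 M hR hn hfree
    · exact c025_core_seven_twentyone_52 M hR hn hfree
    · exact c025_core_seven_twentyone_53 M hR hn hfree
    · exact c025_core_seven_twentyone_54 M hR hn hfree
    · exact c025_core_seven_twentyone_55 M hR hn hfree
    · exact c025_core_seven_twentyone_56 M hR hn hfree
    · exact c025_core_seven_twentyone_57 M hR hn hfree
    · exact c025_core_seven_twentyone_58 M hR hn hfree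
    · exact c025_core_seven_twentyone_59 M hR hn hfree
    · exact c025_core_seven_twentyone_60 M hR hn hfree
    · exact c025_core_seven_twentyone_61 M hR hn hfree
    · exact c025_core_seven_twentyone_62 M hR hn hfree
    · exact c025_core_seven_twentyone_63 M hR hn hfree
    · exact c025_core_seven_twentyone_64 M hR hn hfree
    · exact c025_core_seven_twentyone_65 M hR hn hfree
    · exact c025_core_seven_twentyone_66 M hR hn hfree
    · exact c025_core_seven_twentyone_67 M hR hn hfree
    · exact c025_core_seven_twentyone_68 M hR hn hfree
    · exact c025_core_seven_twentyone_69 M hR hn hfree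
    · exact c025_core_seven_twentyone_70 M hR hn hfree
    · exact c025_core_seven_twentyone_71 M hR hn hfree
    · exact c025_core_seven_twentyone_72 M hR hn hfree
    · exact c025_core_seven_twentyone_73 M hR hn hfree
    · exact c025_core_seven_twentyone_74 M hR hn hfree
    · exact c025_core_seven_twentyone_75 M hR hn hfree
    · exact c025_core_seven_twentyone_76 M hR hn hfree
    · exact c025_core_seven_twentyone_77 M hR hn hfree
    · exact c025_core_seven_twentyone_78 M hR hn hfree
  · exact S4Mid.c025_core_seven_midkey_twentyone M (by omega) hfree

/-- **THEOREM C₇ AT RANK `21`**: level `7` at `p = 21` for every finite matroid (on level `6` at `p = 20`, `c025_six_all`). -/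
theorem c025_seven_at_twentyone (M : Matroid α) [M.Finite] : RLS M 21 7 :=
  rls_seven_at_of_core 21 (by norm_num) (fun M _ => c025_six_all M 20 (by norm_num))
    (fun M _ d hd hR hn hfree => c025_core_seven_twentyone M d hd hR hn hfree) M

end ThmN

end PercRepro
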